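import Literature.MathematicalPhysics.QuantumManyBody.BoseGasSubcellCondensation
import HarnessLib

/-!
# Route `BECInfraredBound`, crux `BecShellMass` (stmt-AtomisticToContinuum-0734),
# line `Sketch`: the registered stub `stub_shellCover`

Supports (does not close) stmt-AtomisticToContinuum-0734; stub `stub_shellCover` of the line
`Sketch` (namespace `Summit.AtomisticToContinuum.BoseEinsteinCondensation.Theorems.BecShellMass`).

**Deterministic cover of the boundary shell by the outer cells.** Divide `Λ_L = (0,L)³`, `L = Ks`,
into the aligned grid of `K³` open cubic cells of side `s` (the cell method of [LSSY2005, (2.52)]: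
`cellCoord`, `cellCorner`, `cellSet` of `LiebYngvasonCellMethod.lean`).  Call a cell `c` OUTER
(for `m` layers) if some lattice coordinate of `c` is `< m` or `≥ K - m`.  For every `C¹` Dirichlet
state `Ψ` of `Λ_L^N` and every shell width `w ≤ m s`,

`Σ_i ∫ 1[X_i ∉ (w, L-w)³] |Ψ(X)|² dX ≤ Σ_{c outer} Σ_σ (∫_{cellSet σ} |Ψ|²) · #{j : σ j = c}`,

the right side being the expected number of particles in the outer cells.

Proof.  The cell sets `cellSet K s σ`, `σ : Fin N → Fin (K³)`, partition `Λ_L^N` up to a null set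
(`boxN_ae_eq_iUnion_cellSet`, `pairwiseDisjoint_cellSet`) and `Ψ` vanishes off `Λ_L^N`, so each
integral splits over the cell sets; on `cellSet K s σ` a particle `i` whose cell `σ i` is NOT outer
has all its coordinates in `(m s, (K-m) s) ⊆ (w, L-w)`, so the shell indicator of particle `i` is
`≤ 1[σ i outer]`; finally `Σ_i 1[σ i ∈ T] = Σ_{c ∈ T} #{j : σ j = c}` and the two finite sums are
exchanged.  The inequality is proved for abstract weights `g i ≤ 1[σ i ∈ T]` and an abstract
density `f` vanishing off the box (`shellCover_abstract`); no measurability is needed.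

## References

* [LSSY2005] E. H. Lieb, R. Seiringer, J. P. Solovej, J. Yngvason, *The Mathematics of the Bose
  Gas and its Condensation*, Oberwolfach Seminars 34, Birkhäuser 2005, (2.52) (the cell method).
-/

noncomputable section

open _root_.MeasureTheory
open scoped ENNReal

namespace Summit.AtomisticToContinuum.BoseEinsteinCondensation.Theorems.BecShellMass

open Literature.MathematicalPhysics.QuantumManyBody.BoseGas

/-! ### Pointwise: a particle of an inner cell lies in the inner box -/

/-- On the cell with lattice coordinates `q = cellCoord K c`, all in `[m, K - m)`, a point `x` with
`x - cellCorner K s c ∈ (0,s)³` has every coordinate in `(w, Ks - w)` as soon as `w ≤ m s`: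
`w ≤ m s ≤ q_j s < x_j < (q_j + 1) s ≤ (K - m) s ≤ K s - w`. [folklore] -/
theorem shellCover_mem_inner {K m : ℕ} {s w : ℝ} (hs : 0 < s) (hw : w ≤ (m : ℝ) * s)
    {c : Fin (K ^ 3)} (hc : ∀ a, m ≤ (cellCoord K c a : ℕ) ∧ (cellCoord K c a : ℕ) + m < K)
    {x : EuclideanSpace ℝ (Fin 3)} (hx : x - cellCorner K s c ∈ box s) :
    x ∈ {x : EuclideanSpace ℝ (Fin 3) | ∀ j, x j ∈ Set.Ioo w ((K : ℝ) * s - w)} := by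
  intro j
  have h := hx j
  simp only [PiLp.sub_apply, cellCorner_apply, Set.mem_Ioo] at h
  obtain ⟨h1, h2⟩ := hc j
  have h2n : (cellCoord K c j : ℕ) + m + 1 ≤ K := h2
  have h1' : (m : ℝ) ≤ (cellCoord K c j : ℕ) := by exact_mod_cast h1
  have h2' : ((cellCoord K c j : ℕ) : ℝ) + m + 1 ≤ K := by exact_mod_cast h2n
  have hm := mul_le_mul_of_nonneg_right h1' hs.le
  have hM := mul_le_mul_of_nonneg_right h2' hs.le
  constructor
  · linarith [h.1]
  · linarith [h.2]

/-! ### Counting: `Σ_i 1[σ i ∈ T] = Σ_{c ∈ T} #{j : σ j = c}` -/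

/-- For an assignment `σ` of cells to particles and a set `T` of cells, the number of particles
whose cell lies in `T` is `Σ_{c ∈ T} #{j : σ j = c}`. [folklore] -/
theorem shellCover_sum_ite_mem_eq {N K : ℕ} (T : Finset (Fin (K ^ 3))) (σ : Fin N → Fin (K ^ 3)) :
    ∑ i : Fin N, (if σ i ∈ T then (1 : ℝ≥0∞) else 0) =
      ∑ c ∈ T, ((Finset.univ.filter fun j => σ j = c).card : ℝ≥0∞) := by
  have h : ∀ i : Fin N,
      (if σ i ∈ T then (1 : ℝ≥0∞) else 0) = ∑ c ∈ T, if σ i = c then (1 : ℝ≥0∞) else 0 :=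
    fun i => (Finset.sum_ite_eq T (σ i) fun _ => (1 : ℝ≥0∞)).symm
  simp_rw [h]
  rw [Finset.sum_comm]
  simp only [Finset.sum_boole]

/-! ### The cover inequality for abstract weights -/

/-- **Abstract cover inequality.** If the density `f` vanishes off `Λ_{Ks}^N` and the per-particle
weights satisfy `g i ≤ 1[σ i ∈ T]` on `cellSet K s σ` for every assignment `σ`, then
`Σ_i ∫ g_i f ≤ Σ_{c ∈ T} Σ_σ (∫_{cellSet σ} f) · #{j : σ j = c}`: split each integral over the
a.e. partition of the box into cell sets, bound `g i` by `1[σ i ∈ T]` on each, count, and exchange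
the sums. [folklore] -/
theorem shellCover_abstract {N K : ℕ} {s : ℝ} (hK : 0 < K) (hs : 0 < s)
    (T : Finset (Fin (K ^ 3))) (g : Fin N → Config N → ℝ≥0∞) (f : Config N → ℝ≥0∞)
    (hf : ∀ X, X ∉ boxN N ((K : ℝ) * s) → f X = 0)
    (hg : ∀ (σ : Fin N → Fin (K ^ 3)) (i : Fin N) (X : Config N), X ∈ cellSet K s σ →
      g i X ≤ if σ i ∈ T then 1 else 0) :
    ∑ i : Fin N, ∫⁻ X, g i X * f X ≤
      ∑ c ∈ T, ∑ σ : Fin N → Fin (K ^ 3),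
        (∫⁻ X in cellSet K s σ, f X) * ((Finset.univ.filter fun j => σ j = c).card : ℝ≥0∞) := by
  -- each integral splits over the cell sets
  have hsplit : ∀ i : Fin N, ∫⁻ X, g i X * f X =
      ∑ σ : Fin N → Fin (K ^ 3), ∫⁻ X in cellSet K s σ, g i X * f X := by
    intro i
    have hsupp : (Function.support fun X => g i X * f X) ⊆ boxN N ((K : ℝ) * s) := by
      intro X hX
      by_contra hXb
      exact hX (by simp [hf X hXb])
    rw [← setLIntegral_eq_of_support_subset hsupp,
      setLIntegral_congr (boxN_ae_eq_iUnion_cellSet (N := N) hs hK),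
      lintegral_iUnion (fun σ => measurableSet_cellSet K s σ) (pairwiseDisjoint_cellSet hs),
      tsum_fintype]
  -- on each cell set the weight of particle `i` is at most `1[σ i ∈ T]`
  have hcell : ∀ (σ : Fin N → Fin (K ^ 3)) (i : Fin N),
      ∫⁻ X in cellSet K s σ, g i X * f X ≤
        (if σ i ∈ T then 1 else 0) * ∫⁻ X in cellSet K s σ, f X := by
    intro σ i
    calc ∫⁻ X in cellSet K s σ, g i X * f X
        ≤ ∫⁻ X in cellSet K s σ, (if σ i ∈ T then 1 else 0) * f X :=
          setLIntegral_mono' (measurableSet_cellSet K s σ) fun X hX =>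
            mul_le_mul' (hg σ i X hX) le_rfl
      _ = (if σ i ∈ T then 1 else 0) * ∫⁻ X in cellSet K s σ, f X :=
          lintegral_const_mul' _ _ (by split_ifs <;> simp)
  calc ∑ i : Fin N, ∫⁻ X, g i X * f X
      = ∑ i : Fin N, ∑ σ : Fin N → Fin (K ^ 3), ∫⁻ X in cellSet K s σ, g i X * f X :=
        Finset.sum_congr rfl fun i _ => hsplit i
    _ ≤ ∑ i : Fin N, ∑ σ : Fin N → Fin (K ^ 3),
          (if σ i ∈ T then 1 else 0) * ∫⁻ X in cellSet K s σ, f X :=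
        Finset.sum_le_sum fun i _ => Finset.sum_le_sum fun σ _ => hcell σ i
    _ = ∑ σ : Fin N → Fin (K ^ 3),
          (∑ i : Fin N, (if σ i ∈ T then (1 : ℝ≥0∞) else 0)) * ∫⁻ X in cellSet K s σ, f X := by
        rw [Finset.sum_comm]
        simp only [Finset.sum_mul]
    _ = ∑ σ : Fin N → Fin (K ^ 3),
          (∑ c ∈ T, ((Finset.univ.filter fun j => σ j = c).card : ℝ≥0∞)) *
            ∫⁻ X in cellSet K s σ, f X := by
        simp only [shellCover_sum_ite_mem_eq]
    _ = ∑ c ∈ T, ∑ σ : Fin N → Fin (K ^ 3),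
          (∫⁻ X in cellSet K s σ, f X) * ((Finset.univ.filter fun j => σ j = c).card : ℝ≥0∞) := by
        simp only [Finset.sum_mul]
        rw [Finset.sum_comm]
        exact Finset.sum_congr rfl fun c _ => Finset.sum_congr rfl fun σ _ => mul_comm _ _

/-! ### The registered stub -/

/-- **Stub `stub_shellCover`** (deterministic cover of the shell by the outer cells): for the
aligned grid of `K³` open cells of side `s` in `Λ_L` (`Ks = L`) and a shell width `w ≤ m s`, the
one-body shell mass `Σ_i ∫ 1[X_i ∉ (w, L-w)³] |Ψ|²` of any Dirichlet trial state is at most the sum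
over the OUTER cells (some lattice coordinate `< m` or `≥ K - m`) of the expected cell numbers
`N_c = Σ_σ mass_σ · #{j : σ j = c}`: a particle of a non-outer cell has all coordinates in
`(m s, (K - m) s) ⊆ (w, L - w)` (`shellCover_mem_inner`), and `shellCover_abstract`.
[cite: LSSY2005, (2.52)] -/
theorem stub_shellCover : ∀ (N K m : ℕ) (s L w : ℝ), 0 < K → 0 < s → (K : ℝ) * s = L → w ≤ (m : ℝ) * s → ∀ Ψ : Literature.MathematicalPhysics.QuantumManyBody.BoseGas.TrialState N L, (∑ i : Fin N, ∫⁻ X, {x : EuclideanSpace ℝ (Fin 3) | ∀ j, x j ∈ Set.Ioo w (L - w)}ᶜ.indicator (fun _ => (1 : ℝ≥0∞)) (X i) * (‖Ψ.ψ X‖₊ : ℝ≥0∞) ^ 2) ≤ ∑ c ∈ Finset.univ.filter (fun c : Fin (K ^ 3) => ∃ a : Fin 3, (Literature.MathematicalPhysics.QuantumManyBody.BoseGas.cellCoord K c a : ℕ) < m ∨ K ≤ (Literature.MathematicalPhysics.QuantumManyBody.BoseGas.cellCoord K c a : ℕ) + m), ∑ σ : Fin N → Fin (K ^ 3), (∫⁻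 X in Literature.MathematicalPhysics.QuantumManyBody.BoseGas.cellSet K s σ, (‖Ψ.ψ X‖₊ : ℝ≥0∞) ^ 2) * ((Finset.univ.filter fun j => σ j = c).card : ℝ≥0∞) := by
  intro N K m s L w hK hs hKs hw Ψ
  subst hKs
  refine shellCover_abstract (N := N) hK hs _
    (fun i X => {x : EuclideanSpace ℝ (Fin 3) | ∀ j, x j ∈ Set.Ioo w ((K : ℝ) * s - w)}ᶜ.indicator
      (fun _ => (1 : ℝ≥0∞)) (X i))
    (fun X => (‖Ψ.ψ X‖₊ : ℝ≥0∞) ^ 2) (fun X hX => by simp [Ψ.eq_zero X hX]) ?_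
  intro σ i X hX
  beta_reduce
  split_ifs with hi
  · exact Set.indicator_apply_le' (fun _ => le_rfl) (fun _ => zero_le_one)
  · simp only [Finset.mem_filter, Finset.mem_univ, true_and, not_exists, not_or, not_lt,
      not_le] at hi
    exact le_of_eq (Set.indicator_of_notMem
      (Set.notMem_compl_iff.2 (shellCover_mem_inner hs hw hi (hX i))) _)

end Summit.AtomisticToContinuum.BoseEinsteinCondensation.Theorems.BecShellMass

end
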